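import Summits.AtomisticToContinuum.HydrodynamicLimit.Theorems.StiffCollisionalRelaxationAprioriBoundsFibreDeficitHoeffding
import Summits.AtomisticToContinuum.HydrodynamicLimit.Theorems.StiffCollisionalRelaxationAprioriBoundsFibreDeficitSlabBounds
import Summits.AtomisticToContinuum.HydrodynamicLimit.Theorems.JaynesSqueezeBlockGibbsToRelEntropyLedger
import Literature.Probability.Entropy.EntropyInequality
import HarnessLib

/-!
# Rate-free entropy transfer: time-integrated relative entropy `o(N)` gives time-integrated bulk tails
(line `fibre-deficit-transfer`, crux `AprioriBounds`, stmt-AtomisticToContinuum-14827; cycle-2 lever)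

Support file (`--supports stmt-AtomisticToContinuum-14827`) of the lead prover of the line.  The cycle-1 lever
(`…FibreDeficitTransfer.stub_deficitTransfer`) transferred a RATED sub-extensive relative entropy `H(μ_s | G_s) ≤ C(N+1)^{1−a}`
to polynomially small tail-fraction events.  Component (i) of the crux is a TIME AVERAGE, and the assembly
(`stub_partOne_of_tails`) consumes the bad events only through `∫₀ᵗ P(bad(K,s)) ds`; so rates are not needed: this file proves
the RATE-FREE, TIME-INTEGRATED lever

  `∫₀ᵗ H(μ_s | G_s) ds = o(N)  ⟹  ∀ δ > 0: sup_K ∫₀ᵗ μ₀{ 2A e^{−K/(2Θ)} + δ < frac_K(Φ_s ·) } ds → 0`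

(`integratedBulkTail_of_klDiv_integrated`, registered sub-goal) for references `G_s = localGibbsLaw σ (b s) (u s) (θ s)` with
ANY continuous positive activities `b s` — the form delivered by Yau-type relative-entropy hydrodynamics (the `RelEntropyVanishing`
family of route items, `klDiv(lawAt μ₀ t ‖ localGibbsLaw σ a (u t) (θ t))/(N+1) → 0`, once integrated in time) and, as a corollary,
by the rated bound of cycle 1.  Ingredients: Hoeffding under `G_s` uniformly in the level (`exists_frac_tail_bound`), the entropy
inequality for events in `ℝ≥0∞` form (`measure_le_klDiv_add_div`, from `KipnisLandim1999_A1_8_2_holds`; trivial when the relative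
entropy is infinite), and MONOTONICITY of the lower Lebesgue integral in `s` (no measurability in time is needed).
-/

noncomputable section

open MeasureTheory Filter Set Topology InformationTheory
open scoped ENNReal

namespace Summit.AtomisticToContinuum.HydrodynamicLimit.Theorems.FibreDeficitTransfer

open Literature.MathematicalPhysics.KineticTheory Literature.Analysis.FluidPDE
open Summit.AtomisticToContinuum.HydrodynamicLimit.Theorems.VisitLedgerUpscattering (Cfg Flow Flows NiceProfiles)
open JaynesSqueezeClosure

/-- **The entropy inequality for events, `ℝ≥0∞` form.**  For probability measures `μ ≪ π` and an event `A` with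
`π A ≤ e^{−L}`, `L > 0`:  `μ A ≤ (log 2 + H(μ | π)) / L` in `ℝ≥0∞` (Kipnis–Landim A1.8.2; trivial if `H = ∞`; `π A = 0` by
absolute continuity). -/
theorem measure_le_klDiv_add_div {Ω : Type} [MeasurableSpace Ω] (μ π : Measure Ω) [IsProbabilityMeasure μ]
    [IsProbabilityMeasure π] (hac : μ ≪ π) {L : ℝ} (hL : 0 < L) {A : Set Ω} (hA : MeasurableSet A)
    (hπA : π A ≤ ENNReal.ofReal (Real.exp (-L))) :
    μ A ≤ (ENNReal.ofReal (Real.log 2) + klDiv μ π) / ENNReal.ofReal L := by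
  by_cases hkl : klDiv μ π = ⊤
  · rw [hkl, _root_.add_top, ENNReal.top_div_of_ne_top ENNReal.ofReal_ne_top]
    exact le_top
  by_cases h0 : π A = 0
  · rw [hac h0]; exact bot_le
  have hq : 0 < (π A).toReal := ENNReal.toReal_pos h0 (measure_ne_top _ _)
  have hqle : (π A).toReal ≤ Real.exp (-L) := ENNReal.toReal_le_of_le_ofReal (Real.exp_pos _).le hπA
  have hKL := Literature.Probability.Entropy.KipnisLandim1999_A1_8_2_holds Ω μ π A hA h0 hkl
  have hlog : L ≤ Real.log (1 + (π A).toReal⁻¹) := by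
    have h1 : Real.exp L ≤ (π A).toReal⁻¹ := by
      have h := inv_anti₀ hq hqle
      rwa [Real.exp_neg, inv_inv] at h
    calc L = Real.log (Real.exp L) := (Real.log_exp L).symm
      _ ≤ Real.log (1 + (π A).toReal⁻¹) := Real.log_le_log (Real.exp_pos L) (by linarith)
  have hH0 : 0 ≤ (klDiv μ π).toReal := ENNReal.toReal_nonneg
  have hreal : (μ A).toReal ≤ (Real.log 2 + (klDiv μ π).toReal) / L :=
    hKL.trans (div_le_div_of_nonneg_left (by positivity) hL hlog)
  rw [← ENNReal.ofReal_toReal (measure_ne_top μ A), ← ENNReal.ofReal_toReal hkl,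
    ← ENNReal.ofReal_add (Real.log_pos (by norm_num)).le hH0, ← ENNReal.ofReal_div_of_pos hL]
  exact ENNReal.ofReal_le_ofReal hreal

/-- **Rate-free, time-integrated entropy transfer** (registered sub-goal `integratedBulkTail_of_klDiv_integrated`).  For
`0 < σ < 1/2`, nice profiles, `t > 0`, slice fields `u, θ > 0` jointly continuous on `[0,t] × 𝕋³` and continuous positive
activities `b s`: if `(N+1)⁻¹ ∫₀ᵗ H(μ_s | localGibbsLaw σ (b s) (u s) (θ s)) ds → 0`, then there are `Θ > 0`, `A` such that for
every `δ > 0` and `ε > 0`, eventually in `N`, for ALL levels `K`, `∫₀ᵗ μ₀{2A e^{−K/(2Θ)} + δ < frac_K(Φ_s ·)} ds ≤ ε`. -/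
theorem integratedBulkTail_of_klDiv_integrated : ∀ (σ : ℝ) (a₀ θ₀ : T3 → ℝ) (u₀ : T3 → V3) (b θ : ℝ → T3 → ℝ) (u : ℝ → T3 → V3) (Φ : (N : ℕ) → HardSphereFlow (Torus.geometry (Fin 3)) (hsDiameter σ N) (N + 1)) (t : ℝ), 0 < σ → σ < 1 / 2 → NiceProfiles a₀ θ₀ u₀ → 0 < t → ContinuousOn (Function.uncurry θ) (Icc 0 t ×ˢ univ) → ContinuousOn (Function.uncurry u) (Icc 0 t ×ˢ univ) → (∀ s ∈ Icc 0 t, ∀ x, 0 < θ s x) → (∀ s ∈ Icc 0 t, Continuous (b s)) → (∀ s ∈ Icc 0 t, ∀ x, 0 < b s x) → Tendsto (fun N : ℕ => (∫⁻ s in Icc 0 t, klDiv ((Φ N).lawAt (localGibbsLaw σ a₀ u₀ θ₀ N (Φ N)) s) (localGibbsLaw σ (b s) (u s) (θ s) N (Φ N))) / ((N : ℝ≥0∞) + 1)) atTop (𝓝 0) → ∃ Θ A : ℝ, 0 < Θ ∧ ∀ δ : ℝ, 0 < δ → ∀ ε : ℝ, 0 < ε → ∃ N₀ : ℕ, ∀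 N : ℕ, N₀ ≤ N → ∀ K : ℝ, ∫⁻ s in Icc 0 t, localGibbsLaw σ a₀ u₀ θ₀ N (Φ N) {z | 2 * A * Real.exp (-(K / (2 * Θ))) + δ < frac K ((Φ N).flow s z)} ≤ ENNReal.ofReal ε := by
  intro σ a₀ θ₀ u₀ b θ u Φ t hσ hσ2 hP ht hθc huc hθ hbc hbpos hKL
  have hσ2' : σ ≤ 1 / 2 := hσ2.le
  have _ := hσ
  obtain ⟨ha, hθ₀, hu₀, ha0, hθ0⟩ := hP
  -- uniform bounds of the slice temperatures and drifts, Hoeffding constants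
  obtain ⟨Θm', -, hΘm'⟩ := exists_bound_slab (f := fun p : ℝ × T3 => θ p.1 p.2) hθc
  obtain ⟨U, -, hU⟩ := exists_bound_slab (f := fun p : ℝ × T3 => ‖u p.1 p.2‖) huc.norm
  set Θm : ℝ := max Θm' 1 with hΘm
  have hΘmpos : 0 < Θm := lt_of_lt_of_le one_pos (le_max_right _ _)
  have hθle : ∀ s ∈ Icc 0 t, ∀ x, θ s x ≤ Θm := fun s hs x =>
    ((le_abs_self _).trans (hΘm' s hs x)).trans (le_max_left _ _)
  have hule : ∀ s ∈ Icc 0 t, ∀ x, ‖u s x‖ ≤ U := fun s hs x => (le_abs_self _).trans (hU s hs x)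
  obtain ⟨Θ, A, hΘ, hA, htail⟩ := exists_frac_tail_bound Θm U hΘmpos
  refine ⟨Θ, A, hΘ, fun δ hδ ε hε => ?_⟩
  -- the budget: `t log 2 + ∫ H ≤ ε δ² (N+1)` eventually
  have hlog2 : 0 < Real.log 2 := Real.log_pos (by norm_num)
  have hsmall : ∀ᶠ N : ℕ in atTop, (∫⁻ s in Icc 0 t, klDiv ((Φ N).lawAt (localGibbsLaw σ a₀ u₀ θ₀ N (Φ N)) s)
      (localGibbsLaw σ (b s) (u s) (θ s) N (Φ N))) ≤ ENNReal.ofReal (ε * δ ^ 2) * ((N : ℝ≥0∞) + 1) := by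
    have hpos : (0 : ℝ≥0∞) < ENNReal.ofReal (ε * δ ^ 2) := ENNReal.ofReal_pos.2 (by positivity)
    filter_upwards [(ENNReal.tendsto_nhds_zero.1 hKL) (ENNReal.ofReal (ε * δ ^ 2)) hpos] with N hNle
    have hN0 : ((N : ℝ≥0∞) + 1) ≠ 0 := by simp
    have hNtop : ((N : ℝ≥0∞) + 1) ≠ ⊤ := by simp
    rwa [ENNReal.div_le_iff hN0 hNtop] at hNle
  obtain ⟨N₁, hN₁⟩ := eventually_atTop.1 hsmall
  obtain ⟨N₂, hN₂⟩ := exists_nat_ge (t * Real.log 2 / (ε * δ ^ 2))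
  refine ⟨max N₁ N₂, fun N hN K => ?_⟩
  have hNN₁ : N₁ ≤ N := (le_max_left _ _).trans hN
  have hNN₂ : N₂ ≤ N := (le_max_right _ _).trans hN
  have hEpos : (0 : ℝ) < (N : ℝ) + 1 := by positivity
  -- pointwise in `s`: the entropy inequality against the Hoeffding bound at `δ`
  set μ₀ := localGibbsLaw σ a₀ u₀ θ₀ N (Φ N) with hμ₀
  haveI hμ₀P : IsProbabilityMeasure μ₀ := isProbabilityMeasure_localGibbsLaw ha hθ₀ hu₀ ha0 hθ0 hσ2' N (Φ N)
  have hLpos : 0 < 2 * ((N : ℝ) + 1) * δ ^ 2 := by positivity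
  have hpt : ∀ s ∈ Icc 0 t, μ₀ {z | 2 * A * Real.exp (-(K / (2 * Θ))) + δ < frac K ((Φ N).flow s z)} ≤
      (ENNReal.ofReal (Real.log 2) + klDiv ((Φ N).lawAt μ₀ s) (localGibbsLaw σ (b s) (u s) (θ s) N (Φ N))) /
        ENNReal.ofReal (2 * ((N : ℝ) + 1) * δ ^ 2) := by
    intro s hs
    have hθs : Continuous (θ s) := continuous_slice hθc hs
    have hus : Continuous (u s) := continuous_slice huc hs
    have hθpos : ∀ x, 0 < θ s x := hθ s hs
    set G := localGibbsLaw σ (b s) (u s) (θ s) N (Φ N) with hG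
    haveI hGP : IsProbabilityMeasure G :=
      isProbabilityMeasure_localGibbsLaw (hbc s hs) hθs hus (hbpos s hs) hθpos hσ2' N (Φ N)
    set μs := (Φ N).lawAt μ₀ s with hμs
    haveI hμsP : IsProbabilityMeasure μs := by
      rw [hμs, HardSphereFlow.lawAt_eq]
      exact Measure.isProbabilityMeasure_map ((Φ N).measurable_flow s).aemeasurable
    have hkl : klDiv μs G ≠ ⊤ :=
      klDiv_lawAt_localGibbsLaw_ne_top hσ2' ha hθ₀ hu₀ ha0 hθ0 (hbc s hs) hθs hus (hbpos s hs) hθpos N (Φ N) s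
    have hac : μs ≪ G := (klDiv_ne_top_iff.1 hkl).1
    set Aev : Set (Cfg N) := {w | 2 * A * Real.exp (-(K / (2 * Θ))) + δ < frac K w} with hAev
    have hAevm : MeasurableSet Aev := measurableSet_lt measurable_const (measurable_frac K)
    have hGA : G Aev ≤ ENNReal.ofReal (Real.exp (-(2 * ((N : ℝ) + 1) * δ ^ 2))) :=
      htail σ (b s) (θ s) (u s) hσ2' (hbc s hs) hθs hus (hbpos s hs) hθpos (hθle s hs) (hule s hs) N (Φ N) K δ hδ.le
    have hmap : μ₀ {z | 2 * A * Real.exp (-(K / (2 * Θ))) + δ < frac K ((Φ N).flow s z)} = μs Aev := by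
      rw [hμs, HardSphereFlow.lawAt_eq, Measure.map_apply ((Φ N).measurable_flow s) hAevm]
      rfl
    rw [hmap]
    exact measure_le_klDiv_add_div μs G hac hLpos hAevm hGA
  -- integrate in `s` (monotonicity of the lower integral; no measurability in time is needed)
  have hconst : Measurable fun _ : ℝ => (ENNReal.ofReal (Real.log 2) : ℝ≥0∞) := measurable_const
  calc ∫⁻ s in Icc 0 t, μ₀ {z | 2 * A * Real.exp (-(K / (2 * Θ))) + δ < frac K ((Φ N).flow s z)}
      ≤ ∫⁻ s in Icc 0 t, (ENNReal.ofReal (Real.log 2) +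
          klDiv ((Φ N).lawAt μ₀ s) (localGibbsLaw σ (b s) (u s) (θ s) N (Φ N))) / ENNReal.ofReal (2 * ((N : ℝ) + 1) * δ ^ 2) :=
        setLIntegral_mono' measurableSet_Icc fun s hs => hpt s hs
    _ = ((∫⁻ s in Icc 0 t, (ENNReal.ofReal (Real.log 2) : ℝ≥0∞)) +
          ∫⁻ s in Icc 0 t, klDiv ((Φ N).lawAt μ₀ s) (localGibbsLaw σ (b s) (u s) (θ s) N (Φ N))) /
          ENNReal.ofReal (2 * ((N : ℝ) + 1) * δ ^ 2) := by
        simp only [div_eq_mul_inv]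
        rw [lintegral_mul_const' _ _ (ENNReal.inv_ne_top.2 (ENNReal.ofReal_pos.2 hLpos).ne'), lintegral_add_left hconst]
    _ ≤ (ENNReal.ofReal (t * Real.log 2) + ENNReal.ofReal (ε * δ ^ 2) * ((N : ℝ≥0∞) + 1)) /
          ENNReal.ofReal (2 * ((N : ℝ) + 1) * δ ^ 2) := by
        gcongr
        · rw [lintegral_const, Measure.restrict_apply_univ, Real.volume_Icc, sub_zero, ← ENNReal.ofReal_mul hlog2.le,
            mul_comm]
        · exact hN₁ N hNN₁
    _ ≤ ENNReal.ofReal ε := by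
        -- `(t log 2 + ε δ² (N+1)) / (2 (N+1) δ²) ≤ ε` since `t log 2 ≤ ε δ² (N+1)`
        have hcast : ((N : ℝ≥0∞) + 1) = ENNReal.ofReal ((N : ℝ) + 1) := by
          rw [ENNReal.ofReal_add (Nat.cast_nonneg N) zero_le_one, ENNReal.ofReal_natCast, ENNReal.ofReal_one]
        rw [hcast, ← ENNReal.ofReal_mul (by positivity), ← ENNReal.ofReal_add (by positivity) (by positivity),
          ← ENNReal.ofReal_div_of_pos hLpos]
        refine ENNReal.ofReal_le_ofReal ?_
        rw [div_le_iff₀ hLpos]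
        have h2 : t * Real.log 2 ≤ ε * δ ^ 2 * ((N : ℝ) + 1) := by
          have h := hN₂.trans (show (N₂ : ℝ) ≤ (N : ℝ) + 1 by exact_mod_cast Nat.le_succ_of_le hNN₂)
          rw [div_le_iff₀ (by positivity)] at h
          linarith
        nlinarith

end Summit.AtomisticToContinuum.HydrodynamicLimit.Theorems.FibreDeficitTransfer

end
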